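import Literature.NumberTheory.LFunctions.ConreyIwaniec2002ThetaOmegaReassembly
import Literature.NumberTheory.LFunctions.ConreyIwaniec2002GaussSumPhase
import HarnessLib

/-!
# Conrey–Iwaniec (2002), §3 (3.14)–(3.18): the `ω`-relation of the class-group theta series
# `θ(·;ψ)` at every cusp — stubs Ω2 `stub_omega_reassembly` and V1 `stub_theta_omega`, proved

B. Conrey, H. Iwaniec, Acta Arith. 103 (2002) 259–312, §§2–3. For `q > 4` odd carrying a primitive
quadratic odd character (so `q` is squarefree and `K = ℚ(√−q)` has `d_K = −q`), every
`ψ ∈ Ĉl(K)`, every `c ≥ 1` and `aā ≡ 1 (mod c)`: with `s = (c,q)`, `r = q/s`, `ψ_s` the genus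
character of `s` ((2.19), by values: `IsGenusCharFor`) and `ψ' = ψ_sψ`, there is `|η| = 1` with
`(iy)⁻¹θ(a/c + i/(c√r·y); ψ) = η·θ(−ā r̄/c + iy/(c√r); ψ')` for all `y > 0`
(`IsOmegaRelated`, `thetaValue`, `thetaConst` of `ConreyIwaniec2002ThetaVoronoiDefs`). In the cell
`landau-siegel/ls-inputs` this is the registered stub V1 `stub_theta_omega` (sub-skeleton
`theta-voronoi`), split by the sub-sub-skeleton `theta-omega` (v1) into Ω1 `stub_gauss_sum_genus`
(the genus phase of the Gauss sums — tree `gauss_sum_genus`) and Ω2 `stub_omega_reassembly` (the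
reassembly over `Cl(K)`). This file PROVES (theorems only, no definitions, no named facts):

* `exists_genusIdeal_data` — the ramified ideal `𝔰 = (s, ω − k₁)` over a divisor `s` of the
  squarefree odd `q = −d_K` (`s ∣ 2k₁ − t`, `sC₁ = k₁² − tk₁ − m`, `(s, C₁) = 1`);
* `omega_reassembly` — **Ω2, registered text verbatim**, from `omegaRelated_of_gaussSum_phase`
  (tree: Poisson summation class by class, `binaryTheta_cusp_omega_relation`, the dual lattice sums
  as class thetas of `[𝔰]𝒜`, regrouping over `Cl(K)`), the `𝔰`-data, `ψ_s² = 1`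
  (`mul_self_eq_one_of_isGenusCharFor`) and `ψψ_s = ψ_sψ`;
* `theta_omega` — **V1, registered text verbatim**: `gauss_sum_genus` (Ω1) + `omega_reassembly`
  (Ω2), `ψ' := ψ_sψ` (`exists_isGenusCharFor`), an integral basis `(1, ω)`.

«The programme SEARCHES and TYPES; no claim about Landau–Siegel zeros, Theorems 1–2 of
arXiv:2211.02515 or a repaired Margin232 until a kernel theorem says so.»

## References

* [ConreyIwaniec2002] B. Conrey, H. Iwaniec, Acta Arith. 103 (2002) 259–312: §2 (2.19)–(2.20),
  (2.27)–(2.31), Proposition 2.1 (2.35)–(2.38); §3 Propositions 3.2/3.3, (3.3)–(3.4), (3.14)–(3.18).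
* [Cox2013] D. A. Cox, *Primes of the form x² + ny²*, 2nd ed. (2013), §3.B Thm. 3.15, §7.B Thm. 7.7.
-/

noncomputable section

open scoped NumberField
open Complex Module NumberField Ideal
open Literature.NumberTheory.QuadraticFields.BinaryQuadraticForm (reducedForms)
open Literature.NumberTheory.QuadraticFields.Quadratic
open Literature.NumberTheory.ModularForms (binQuadGaussSum)

namespace Literature.NumberTheory.LFunctions

namespace ConreyIwaniec2002

open NumberField Literature.NumberTheory.LFunctions.NumberField

variable {K : Type*} [Field K] [NumberField K]

/-! ### The ramified ideal over `s = (c, q)` -/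

/-- **The ramified ideal `𝔰 = (s, ω − k₁)` over a divisor `s` of the squarefree odd `q = −d_K`**:
there are `k₁, C₁` with `s ∣ 2k₁ − t`, `sC₁ = k₁² − tk₁ − m` and `gcd(s, C₁) = 1` (so `𝔰² = (s)`,
`N𝔰 = s`): `s = 2j + 1`, `k₁ = t(j+1)`, `4(k₁² − tk₁ − m) = t²s² + q`, and `(s, q/s) = 1`.
[cite: ConreyIwaniec2002, §3 (3.16)–(3.17)] -/
theorem exists_genusIdeal_data {q : ℕ} (hsqf : Squarefree q) (hodd : Odd q) {t m : ℤ}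
    (hDq : t ^ 2 + 4 * m = -(q : ℤ)) {s : ℕ} (hs : s ∣ q) :
    Odd (s : ℤ) ∧ ∃ k₁ C₁ : ℤ, (s : ℤ) ∣ 2 * k₁ - t ∧ (s : ℤ) * C₁ = k₁ ^ 2 - t * k₁ - m ∧
      IsCoprime (s : ℤ) C₁ := by
  have hsodd : Odd s := hodd.of_dvd_nat hs
  obtain ⟨r, hr⟩ := hs
  have hcop : IsCoprime (s : ℤ) (r : ℤ) :=
    Nat.isCoprime_iff_coprime.mpr (Nat.coprime_of_squarefree_mul (hr ▸ hsqf))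
  obtain ⟨j, hj⟩ := hsodd
  have hs' : (s : ℤ) = 2 * j + 1 := by rw [hj]; push_cast; ring
  have hq' : (q : ℤ) = s * r := by rw [hr]; push_cast; ring
  refine ⟨(Int.odd_coe_nat s).mpr ⟨j, hj⟩, t * (j + 1), ?_⟩
  -- `4N = s·(t²s + r)` with `N = k₁² − tk₁ − m`
  have hq'' : (q : ℤ) = (2 * j + 1) * r := by rw [← hs']; exact hq'
  have h4 : 4 * ((t * (j + 1)) ^ 2 - t * (t * (j + 1)) - m) = (s : ℤ) * (t ^ 2 * s + r) := by
    rw [hs']; linear_combination (-1 : ℤ) * hDq + hq''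
  have hs4 : IsCoprime (s : ℤ) 4 := ⟨(s : ℤ), -(j ^ 2 + j), by rw [hs']; ring⟩
  obtain ⟨C₁, hC₁⟩ : (s : ℤ) ∣ (t * (j + 1)) ^ 2 - t * (t * (j + 1)) - m :=
    hs4.dvd_of_dvd_mul_left ⟨t ^ 2 * s + r, by linear_combination h4⟩
  refine ⟨C₁, ⟨t, by rw [hs']; ring⟩, hC₁.symm, ?_⟩
  have hs0 : (s : ℤ) ≠ 0 := by rw [hs']; omega
  have h4C : 4 * C₁ = r + t ^ 2 * s :=
    mul_left_cancel₀ hs0 (by linear_combination (-4 : ℤ) * hC₁ + h4)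
  exact (show IsCoprime (s : ℤ) (4 * C₁) by
    rw [h4C]; exact hcop.add_mul_right_right _).of_mul_right_right

/-! ### Ω2 `stub_omega_reassembly` -/

/-- **Ω2 — reassembly over `Cl(K)`: the `ω`-relation for `θ(·;ψ)` from the genus phase** — the
registered stub `stub_omega_reassembly` of the sub-sub-skeleton `theta-omega` (v1), VERBATIM (print
(3.16)–(3.18): `θ(·;ψ)|_ω = ηθ(·;ψψ_s)`; (2.36)–(2.38) in the Eisenstein case): for `q > 4` odd with
a primitive quadratic odd character, `K` with `d_K = −q` and integral basis `(1, ω)`, `ω² = m + tω`,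
`ψ, ψ_s ∈ Ĉl(K)` with `ψ_s` the genus character of `s = (c,q)`, `aā ≡ 1 (c)`: IF
`G(a,c;Q,0) = E·ψ_s([𝔞_Q])` for all reduced `Q` with `‖E‖ = c√s`, THEN there is `|η| = 1`
(namely `η = −i·(E/(c√s))·ν_{ψψ_s}(𝔰)`, `𝔰` the ramified ideal of norm `s`) with
`(iy)⁻¹θ(a/c + i/(c√r y); ψ) = η·θ(−ā r̄/c + iy/(c√r); ψ_sψ)` for all `y > 0`. Proof:
`omegaRelated_of_gaussSum_phase` with the `𝔰`-data of `exists_genusIdeal_data` (`q` squarefree by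
`squarefree_of_isPrimitive_of_isQuadratic`), `t² + 4m = d_K = −q` (coordinates in the basis),
`ψ_s² = 1` (`mul_self_eq_one_of_isGenusCharFor`) and `ψψ_s = ψ_sψ`. [cite: ConreyIwaniec2002, §3
(3.3)–(3.4), (3.16)–(3.18); Proposition 2.1 (2.36)–(2.38); §2 (2.15)–(2.17)] -/
theorem omega_reassembly :
    ∀ (q : ℕ) [NeZero q], 4 < q → Odd q → ∀ χ : DirichletCharacter ℂ q,
      χ.IsPrimitive → χ.IsQuadratic → χ.Odd →
        ∀ (K : Type) [Field K] [NumberField K],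
          Module.finrank ℚ K = 2 → NumberField.discr K = -(q : ℤ) →
            ∀ (b : Basis (Fin 2) ℤ (𝓞 K)), b 0 = 1 → ∀ (t m : ℤ),
              b 1 * b 1 = (m : 𝓞 K) + (t : 𝓞 K) * b 1 →
                ∀ (ψ ψs : ClassGroup (𝓞 K) →* ℂˣ) (c : ℕ) [NeZero c],
                  IsGenusCharFor ψs (Nat.gcd c q) →
                    ∀ a abar : ℤ, a * abar ≡ 1 [ZMOD c] →
                      ∀ E : ℂ, ‖E‖ = (c : ℝ) * Real.sqrt (Nat.gcd c q : ℕ) →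
                        (∀ Q ∈ reducedForms (t ^ 2 + 4 * m),
                          binQuadGaussSum c ⟨Q.1, Q.2.1, Q.2.2⟩ (a : ZMod c) 0 0 =
                            E * classGroupCharIdealHom ψs
                              (span {(Q.1 : 𝓞 K), b 1 - (((Q.2.1 + t) / 2 : ℤ) : 𝓞 K)})) →
                        ∃ η : ℂ, ‖η‖ = 1 ∧
                          IsOmegaRelated ((c : ℝ) * Real.sqrt (q / Nat.gcd c q : ℕ)) η
                            (twistCount K (classGroupCharIdealHom ψ))
                            (twistCount K (classGroupCharIdealHom (ψs * ψ)))
                            (thetaConst K ψ) (thetaConst K (ψs * ψ))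
                            ((a : ℝ) / c)
                            (-((abar * ((((q / Nat.gcd c q : ℕ) : ZMod c)⁻¹).val : ℤ) : ℤ) : ℝ) /
                              c) := by
  intro q _ hq4 hqodd χ hprim hquad _ K _ _ h2 hdisc b hb t m hω ψ ψs c _ hψs a abar hab E hE hphase
  classical
  have hsqf : Squarefree q :=
    Literature.NumberTheory.LFunctions.PrimitiveQuadratic.squarefree_of_isPrimitive_of_isQuadratic
      hqodd hprim hquad
  have hm : b.repr (b 1 * b 1) 0 = m := by
    rw [hω]; exact repr_intCast_add_intCast_mul_zero b hb m t
  have ht : b.repr (b 1 * b 1) 1 = t := by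
    rw [hω]; exact repr_intCast_add_intCast_mul_one b hb m t
  have hDq : t ^ 2 + 4 * m = -(q : ℤ) := by rw [← hdisc, discr_eq_sq_add_four_mul b hb, hm, ht]
  have hD : t ^ 2 + 4 * m < -4 := by rw [hDq]; omega
  have hd : NumberField.discr K < -4 := by rw [hdisc]; omega
  have hss : ψs * ψs = 1 :=
    mul_self_eq_one_of_isGenusCharFor (Nat.gcd_ne_zero_right (NeZero.ne q)) hψs
  obtain ⟨hsodd, k₁, C₁, hk₁, hC₁, hcop⟩ :=
    exists_genusIdeal_data hsqf hqodd hDq (Nat.gcd_dvd_right c q)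
  rw [mul_comm ψs ψ]
  exact omegaRelated_of_gaussSum_phase b hb hω hD h2 hd hsqf hDq c hsodd hk₁ hC₁ hcop ψ ψs hss a
    abar hab E hE hphase

/-! ### V1 `stub_theta_omega` -/

/-- **Conrey–Iwaniec §3 (3.14)–(3.18): the `ω`-relation of `θ(·;ψ)` at every cusp — the registered
stub V1 `stub_theta_omega` of the sub-skeleton `theta-voronoi`, VERBATIM** (= the kernel composition
`theta_omega_of` of the sub-sub-skeleton `theta-omega` with both stubs discharged). For `q > 4` odd
with a primitive quadratic odd character mod `q`, `K` quadratic with `d_K = −q`, `ψ ∈ Ĉl(K)`,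
`c ≥ 1`: with `ψ' = ψ_sψ`, `ψ_s` the genus character of `s = (c,q)` (`IsGenusCharFor (ψ'ψ⁻¹) s`),
for all `aā ≡ 1 (mod c)` there is `|η| = 1` with
`(iy)⁻¹ θ(a/c + i/(c√r y); ψ) = η θ(−ā r̄/c + iy/(c√r); ψ')` (`r = q/s`, `r r̄ ≡ 1 (mod c)`), i.e.
`IsOmegaRelated (c√r) η λ_ψ λ_{ψ'} (thetaConst ψ) (thetaConst ψ') (a/c) (−ā r̄/c)`. Assembled from
`exists_isGenusCharFor`, an integral basis `(1, ω)` (`exists_basis_zero_eq_one`,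
`basis_one_mul_self_eq`), Ω1 `gauss_sum_genus` (the genus phase of the Gauss sums) and Ω2
`omega_reassembly`.
[cite: ConreyIwaniec2002, §3 Propositions 3.2/3.3, (3.3)–(3.4), (3.14)–(3.18)] -/
theorem theta_omega :
    ∀ (q : ℕ) [NeZero q], 4 < q → Odd q → ∀ χ : DirichletCharacter ℂ q,
      χ.IsPrimitive → χ.IsQuadratic → χ.Odd →
        ∀ (K : Type) [Field K] [NumberField K],
          Module.finrank ℚ K = 2 → NumberField.discr K = -(q : ℤ) →
            ∀ (ψ : ClassGroup (𝓞 K) →* ℂˣ) (c : ℕ), 1 ≤ c →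
              ∃ ψ' : ClassGroup (𝓞 K) →* ℂˣ, IsGenusCharFor (ψ' * ψ⁻¹) (Nat.gcd c q) ∧
                ∀ a abar : ℤ, a * abar ≡ 1 [ZMOD c] →
                  ∃ η : ℂ, ‖η‖ = 1 ∧
                    IsOmegaRelated ((c : ℝ) * Real.sqrt (q / Nat.gcd c q : ℕ)) η
                      (twistCount K (classGroupCharIdealHom ψ))
                      (twistCount K (classGroupCharIdealHom ψ'))
                      (thetaConst K ψ) (thetaConst K ψ')
                      ((a : ℝ) / c)
                      (-((abar * ((((q / Nat.gcd c q : ℕ) : ZMod c)⁻¹).val : ℤ) : ℤ) : ℝ) / c) := by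
  intro q _ hq hodd χ hprim hquad hoddχ K _ _ h2 hdisc ψ c hc
  classical
  obtain ⟨ψs, hψs, -⟩ :=
    exists_isGenusCharFor q hodd χ hprim hquad K h2 hdisc (Nat.gcd_dvd_right c q)
  refine ⟨ψs * ψ, ?_, ?_⟩
  · have hcancel : ψs * ψ * ψ⁻¹ = ψs :=
      MonoidHom.ext fun A ↦ by
        simp only [MonoidHom.mul_apply, MonoidHom.inv_apply, mul_inv_cancel_right]
    rw [hcancel]
    exact hψs
  intro a abar hab
  haveI : NeZero c := ⟨by omega⟩
  obtain ⟨b, hb⟩ := exists_basis_zero_eq_one h2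
  have hω := basis_one_mul_self_eq b hb
  obtain ⟨E, hE, hphase⟩ :=
    gauss_sum_genus q hq hodd χ hprim hquad hoddχ K h2 hdisc b hb _ _ hω c ψs hψs a abar hab
  exact omega_reassembly q hq hodd χ hprim hquad hoddχ K h2 hdisc b hb _ _ hω ψ ψs c hψs a abar hab
    E hE hphase

end ConreyIwaniec2002

end Literature.NumberTheory.LFunctions

end
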